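import Literature.AlgebraicGeometry.Limits.LocalizationRelativeSmoothSpread
import Literature.AlgebraicGeometry.Limits.RelativeDimensionDescent
import HarnessLib

/-!
# Limits of schemes: the relative dimension of a smooth stage model spreads from the generic fibre
# (EGA IV₄ 17.7.8 with the relative dimension; Görtz–Wedhorn I Prop. 6.15; RELATIVE to a quasi-compact base `P`)

Topic `Literature/AlgebraicGeometry/Limits`; namespace `Literature.AlgebraicGeometry.Limits.LocApprox`; sequel of ★
`LocalizationRelativeSmoothSpread` (A-p14 (g33): the TOTAL-SPACE LOCUS LEMMA `exists_stage_range_fst_subset` and the relative smooth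
spread) and of ★ `RelativeDimensionDescent` (the relative dimension of a smooth morphism is read off on an open meeting a base change).
THEOREMS ONLY (no definition, no named fact, no instance, no notation, no `sorry`; net Literature debt 0).  Cell `hodgecm-mathlib` (D-0151),
programme F0∕P6 «MOD», SPREAD door, organ **(SP1-g)** «relative dimension rider» of the census «abelian-scheme spread over a LocApprox
stage» (LEAD F0P6-plan (g2) 2026-09-01 20:42:56Z ∕ 20:57:43Z); `--supports stmt-HodgeConjecture-24832`, count-neutral.  HONEST LABEL: HC_CM is
proved only modulo the 2 remaining named inputs (hLiu418 24832, h413 24833) until rung 0 closes; this file discharges none of them.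

* `smoothOfRelativeDimension_eq_of_mem_range` — if `Y → P ⊗ D(t)` is smooth, of relative dimension `d` on an open `V ∋ y`, and `y` is in
  the image of a base change `Y ×_{P ⊗ D(t)} Q → Y` whose second projection is smooth of relative dimension `n`, then `d = n` (the step
  «`d = n` on a non-empty open» of ★ `smoothOfRelativeDimension_of_isPullback_of_denseRange`, pointwise).
* `exists_stage_smoothOfRelativeDimension` — **for `Y → P ⊗ D(t)` smooth and quasi-compact with generic fibre
  `Y ×_{P ⊗ D(t)} (P ⊗ Spec B) → P ⊗ Spec B` smooth of relative dimension `n`, some restriction `Y ×_{P ⊗ D(t)} (P ⊗ D(s)) → P ⊗ D(s)`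
  is smooth of relative dimension `n`**: the locus where `Y → P ⊗ D(t)` is smooth of relative dimension `n` is open (Mathlib's
  definition is local on the source; ★ `Motives.exists_opens_smoothOfRelativeDimension_of_smooth`) and contains the image of the generic
  fibre (first bullet), hence the image of a restriction (★ `exists_stage_range_fst_subset`, Stacks 01Z3), on which the relative dimension
  is then `n` (Zariski-local on the source).

## References

* [EGAIV4] A. Grothendieck, J. Dieudonné, EGA IV₄ (Publ. Math. IHÉS 32, 1967), Prop. 17.7.8.
* [GortzWedhorn2020] U. Görtz, T. Wedhorn, *Algebraic Geometry I: Schemes*, 2nd ed. (2020), Prop. 6.15, Thm. 10.57.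
* [Hartshorne1977] R. Hartshorne, *Algebraic Geometry* (1977), Ch. III Prop. 10.1 (b).
* [StacksProject] The Stacks project, Tags 01Z3, 02NM.
-/

set_option autoImplicit false

noncomputable section

universe u

open CategoryTheory CategoryTheory.Limits AlgebraicGeometry MonoidalCategory CartesianMonoidalCategory TopologicalSpace

namespace Literature.AlgebraicGeometry.Limits

namespace LocApprox

open Literature.AlgebraicGeometry.Motives (SchemeOver specOver)

set_option backward.isDefEq.respectTransparency false

/-- **The relative dimension of a smooth morphism on an open meeting the image of a base change is that of the base change.**  Let
`(pr, f'; f, i)` be a cartesian square of schemes with `f'` smooth of relative dimension `n`, and `V` an open of the source of `f` on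
which `f` is smooth of relative dimension `d`, containing a point `pr x'`.  Then `d = n`: over the non-empty open `pr⁻¹ V`, `f'` is smooth
of relative dimension `d` (base change) and `n` (restriction).  [cite: Hartshorne1977, Ch. III Prop. 10.1 (b)]
[cite: GortzWedhorn2020, Prop. 6.15] -/
theorem smoothOfRelativeDimension_eq_of_mem_range {X X' T T' : Scheme.{u}} {f : X ⟶ T} {f' : X' ⟶ T'} {pr : X' ⟶ X}
    {i : T' ⟶ T} (H : IsPullback pr f' f i) {n d : ℕ} [hn : SmoothOfRelativeDimension n f'] (V : X.Opens)
    (hV : SmoothOfRelativeDimension d (V.ι ≫ f)) (x' : X') (hx' : pr.base x' ∈ V) : d = n := by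
  haveI : Nonempty ((pr ⁻¹ᵁ V : X'.Opens) : Scheme.{u}) := ⟨⟨x', hx'⟩⟩
  have sq : IsPullback (pr ∣_ V) ((pr ⁻¹ᵁ V).ι ≫ f') (V.ι ≫ f) i := (isPullback_morphismRestrict pr V).paste_vert H
  haveI := smoothOfRelativeDimension_isStableUnderBaseChange (n := d)
  have h₁ : SmoothOfRelativeDimension d ((pr ⁻¹ᵁ V).ι ≫ f') := MorphismProperty.of_isPullback sq hV
  have h₂ : SmoothOfRelativeDimension n ((pr ⁻¹ᵁ V).ι ≫ f') := IsZariskiLocalAtSource.comp hn _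
  exact Literature.AlgebraicGeometry.Motives.AbelianVarietyProofs.eq_of_smoothOfRelativeDimension _ h₁ h₂

variable {A : Type u} [CommRing A] {S : Submonoid A} (B : Type u) [CommRing B] [Algebra A B] [IsLocalization S B]
variable (P : SchemeOver A) [QuasiCompact P.hom]

/-- **RELATIVE-DIMENSION SPREAD OVER A LocApprox STAGE** (EGA IV₄ 17.7.8 with Hartshorne III 10.1 (b), relative to `P`): let
`P → Spec A` be quasi-compact and `Y → P ⊗ D(t)` smooth and quasi-compact whose generic fibre `Y ×_{P ⊗ D(t)} (P ⊗ Spec B) → P ⊗ Spec B`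
(`B = A_S`) is smooth of relative dimension `n`.  Then for some finer stage `ρ : s ⟶ t` the restriction
`Y ×_{P ⊗ D(t)} (P ⊗ D(s)) → P ⊗ D(s)` is smooth of relative dimension `n`.  [cite: EGAIV4, Prop. 17.7.8]
[cite: Hartshorne1977, Ch. III Prop. 10.1 (b)] [cite: StacksProject, Tag 01Z3] -/
theorem exists_stage_smoothOfRelativeDimension {t : Idx S} (Y : Over (P ⊗ (baseDiagram S).obj t).left) [QuasiCompact Y.hom]
    [Smooth Y.hom] (n : ℕ) (h : SmoothOfRelativeDimension n (pullback.snd Y.hom (P ◁ leg S B t).left)) :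
    ∃ (s : Idx S) (ρ : s ⟶ t), SmoothOfRelativeDimension n (pullback.snd Y.hom (P ◁ (baseDiagram S).map ρ).left) := by
  choose V d hxV hV using Literature.AlgebraicGeometry.Motives.exists_opens_smoothOfRelativeDimension_of_smooth Y.hom
  -- the locus where `Y → P ⊗ D(t)` is smooth of relative dimension `n` contains the image of the generic fibre
  let U : Y.left.Opens := ⨆ (x : Y.left) (_ : d x = n), V x
  have hU : Set.range (pullback.fst Y.hom (P ◁ leg S B t).left) ⊆ (U : Set Y.left) := by
    rintro _ ⟨x', rfl⟩
    haveI := h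
    have hdn : d ((pullback.fst Y.hom (P ◁ leg S B t).left).base x') = n :=
      smoothOfRelativeDimension_eq_of_mem_range (IsPullback.of_hasPullback Y.hom (P ◁ leg S B t).left) (V _) (hV _) x' (hxV _)
    exact Opens.mem_iSup.mpr ⟨_, Opens.mem_iSup.mpr ⟨hdn, hxV _⟩⟩
  -- hence the image of a restriction, which is covered by the opens `pr⁻¹ V x`, `d x = n`
  obtain ⟨s, ρ, hs⟩ := exists_stage_range_fst_subset (B := B) P Y U hU
  refine ⟨s, ρ, ?_⟩
  have hcov : ⨆ (x : {x : Y.left // d x = n}), (pullback.fst Y.hom (P ◁ (baseDiagram S).map ρ).left) ⁻¹ᵁ V x.1 = ⊤ := by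
    refine top_le_iff.mp fun z _ => ?_
    have hz : (pullback.fst Y.hom (P ◁ (baseDiagram S).map ρ).left).base z ∈ (U : Set Y.left) := hs ⟨z, rfl⟩
    obtain ⟨x, hx⟩ := Opens.mem_iSup.mp hz
    obtain ⟨hdx, hzx⟩ := Opens.mem_iSup.mp hx
    exact Opens.mem_iSup.mpr ⟨⟨x, hdx⟩, hzx⟩
  refine IsZariskiLocalAtSource.of_iSup_eq_top (P := @SmoothOfRelativeDimension n) _ hcov fun x => ?_
  have sq : IsPullback ((pullback.fst Y.hom (P ◁ (baseDiagram S).map ρ).left) ∣_ V x.1)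
      (((pullback.fst Y.hom (P ◁ (baseDiagram S).map ρ).left) ⁻¹ᵁ V x.1).ι ≫ pullback.snd Y.hom (P ◁ (baseDiagram S).map ρ).left)
      ((V x.1).ι ≫ Y.hom) (P ◁ (baseDiagram S).map ρ).left :=
    (isPullback_morphismRestrict _ (V x.1)).paste_vert (IsPullback.of_hasPullback Y.hom (P ◁ (baseDiagram S).map ρ).left)
  haveI := smoothOfRelativeDimension_isStableUnderBaseChange (n := n)
  have hVn : SmoothOfRelativeDimension n ((V x.1).ι ≫ Y.hom) := by
    obtain ⟨x, hx⟩ := x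
    subst hx
    exact hV x
  exact MorphismProperty.of_isPullback sq hVn

end LocApprox

end Literature.AlgebraicGeometry.Limits

end
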